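import Summits.ValiantsHypothesis.ValiantsHypothesis.Theorems.KPlusLogSqLawStaticPathTransposition

/-!
# Route «KPlusLogSqLaw» — parametric max-weight independent set on a path: THE EVENT TEST

HONEST FRAMING.  Helper toward the crux `WeakLifting` (item `stmt-ValiantsHypothesis-19561`, route `KPlusLogSqLaw`, cell `pub-symmetroid`,
seat val-sym-lift-p4 g8, 2026-08-27) on the line of its witness-plan stub `stub_tridiagonalSectorB` (tropical twin of the STATIC tridiagonal
sector = parametric maximum-weight independent set on a path; located theory `HOME/val-sym-lift-p4/LINEAR-LAW.md` §2–§3, there validated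
numerically by two seats on 1 000+ instances).  Fourth file of the record calculus.  For the block `i+1, …, i+n` with signed prefix-sum lines
`S_0, …, S_n` (and `S'_0, …, S'_n` for the reversed block), and two parameters `θ, θ'` across an ADJACENT TRANSPOSITION of the pair `(S_α, S_κ)`,
`α < κ ≤ n` (all other pairs keep their order, values distinct, no third line between the pair at `θ` — the two sides of one simple crossing),
with unique optima `M` at `θ` and `M'` at `θ'`:
* (parity) an independent subset leaves `n + 1 - 2|M|` positions uncovered (`card_uncovered_add`), so two independent subsets never differ in
  exactly one uncovered position (`uncovered_iff_of_all_but_one`);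
* every position other than `α`, `κ` keeps its uncovered-status (`uncovered_iff_of_transposition`);
* **THE EVENT TEST** (`ne_iff_event`): `M ≠ M'` iff the pair does change order AND `α` is a left record at `θ` AND the stretch `(α, κ)` is clean at
  `θ` (every `S_x`, `α < x < κ`, strictly on its correct side of `S_α`) AND `κ` is a right record at `θ`;
* and then BOTH ends toggle and nothing else does (`toggle_ends_of_ne`; LINEAR-LAW §3(c)).
Consequence (not formalised here): along a generic sweep of `θ` the changes of the optimal set are in bijection with the crossings `(α, κ)` of
the arrangement `S_0, …, S_n` passing this test — the dual-plane counting model of LINEAR-LAW §2 (tools/dual.py) is thereby justified in the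
kernel up to the genericity conventions.  Statements about a path DP; nothing here asserts anything about `WeakLifting`, `TropicalB`,
`KPlusLogSqLaw`, the stub in its window, `MatrixDescartes` (stmt-ValiantsHypothesis-18050) or `VP ≠ VNP`.
-/

set_option linter.dupNamespace false
set_option autoImplicit false

namespace Summit.ValiantsHypothesis.ValiantsHypothesis.Theorems.KPlusLogSqLaw

open Finset Classical

namespace StaticPathFold

noncomputable section

section Events

variable (w₁ w₀ : ℕ → ℝ)

/-! ## 1. Uncovered positions: the parity invariant -/

/-- **parity invariant**: the number of positions `x ≤ n` left uncovered by an independent subset `M` of the block `i+1, …, i+n` plus twice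
`|M|` is `n + 1` — each item covers two positions and the items of `M` are pairwise non-adjacent. [folklore] -/
theorem card_uncovered_add {i n : ℕ} {M : Finset ℕ} (hM : M ∈ indepSets i n) :
    ((range (n + 1)).filter (fun x => i + x ∉ M ∧ i + x + 1 ∉ M)).card + 2 * M.card = n + 1 := by
  rcases mem_indepSets.mp hM with ⟨hM1, hM2⟩
  have hbd : ∀ t ∈ M, i + 1 ≤ t ∧ t ≤ i + n := fun t ht => by have := mem_Ioc.mp (hM1 ht); omega
  -- covered positions: `t - i - 1` (left end) and `t - i` (right end) of each item `t ∈ M`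
  set A := M.image (fun t => t - i - 1) with hA
  set B := M.image (fun t => t - i) with hB
  have hAc : A.card = M.card := by
    apply card_image_of_injOn
    intro s hs t ht h
    have := hbd s hs; have := hbd t ht; simp only at h; omega
  have hBc : B.card = M.card := by
    apply card_image_of_injOn
    intro s hs t ht h
    have := hbd s hs; have := hbd t ht; simp only at h; omega
  have hAB : Disjoint A B := by
    rw [disjoint_left]
    intro x hxA hxB
    obtain ⟨s, hs, rfl⟩ := mem_image.mp hxA
    obtain ⟨t, ht, hts⟩ := mem_image.mp hxB
    have := hbd s hs; have := hbd t ht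
    have hts' : t - i = s - i - 1 := hts
    have h1 : t + 1 = s := by omega
    exact hM2 t ht (h1 ▸ hs)
  have hsub : A ∪ B ⊆ range (n + 1) := by
    intro x hx
    rw [mem_range]
    rcases mem_union.mp hx with h | h
    · obtain ⟨s, hs, rfl⟩ := mem_image.mp h; have := hbd s hs; omega
    · obtain ⟨s, hs, rfl⟩ := mem_image.mp h; have := hbd s hs; omega
  have heq : (range (n + 1)).filter (fun x => i + x ∉ M ∧ i + x + 1 ∉ M) = range (n + 1) \ (A ∪ B) := by
    ext x
    simp only [mem_filter, mem_sdiff, mem_union, mem_range, hA, hB, mem_image, not_or, not_exists, not_and]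
    constructor
    · rintro ⟨hx, h1, h2⟩
      refine ⟨hx, fun s hs h => ?_, fun s hs h => ?_⟩
      · have := hbd s hs
        exact h2 (by rwa [show i + x + 1 = s by omega])
      · have := hbd s hs
        exact h1 (by rwa [show i + x = s by omega])
    · rintro ⟨hx, h1, h2⟩
      exact ⟨hx, fun h => h2 _ h (by omega), fun h => h1 _ h (by omega)⟩
  have hle : 2 * M.card ≤ n + 1 := by
    have h := card_le_card hsub
    rw [card_union_of_disjoint hAB, hAc, hBc, card_range] at h
    omega
  rw [heq, card_sdiff_of_subset hsub, card_range, card_union_of_disjoint hAB, hAc, hBc]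
  omega

/-- hence **two independent subsets never differ in exactly one uncovered position**: if all positions but `y` have the same uncovered-status
for `M` and `M'`, so does `y`. [folklore] -/
theorem uncovered_iff_of_all_but_one {i n y : ℕ} {M M' : Finset ℕ} (hM : M ∈ indepSets i n) (hM' : M' ∈ indepSets i n)
    (h : ∀ x, x ≤ n → x ≠ y → ((i + x ∉ M ∧ i + x + 1 ∉ M) ↔ (i + x ∉ M' ∧ i + x + 1 ∉ M'))) :
    (i + y ∉ M ∧ i + y + 1 ∉ M) ↔ (i + y ∉ M' ∧ i + y + 1 ∉ M') := by
  rcases mem_indepSets.mp hM with ⟨hM1, _⟩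
  rcases mem_indepSets.mp hM' with ⟨hM1', _⟩
  by_cases hy : y ≤ n
  swap
  · -- outside the block both items are absent from both sets
    have a1 : i + y ∉ M := fun hh => by have := mem_Ioc.mp (hM1 hh); omega
    have a2 : i + y + 1 ∉ M := fun hh => by have := mem_Ioc.mp (hM1 hh); omega
    have a3 : i + y ∉ M' := fun hh => by have := mem_Ioc.mp (hM1' hh); omega
    have a4 : i + y + 1 ∉ M' := fun hh => by have := mem_Ioc.mp (hM1' hh); omega
    exact ⟨fun _ => ⟨a3, a4⟩, fun _ => ⟨a1, a2⟩⟩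
  have hc := card_uncovered_add hM
  have hc' := card_uncovered_add hM'
  set U := (range (n + 1)).filter (fun x => i + x ∉ M ∧ i + x + 1 ∉ M) with hU
  set U' := (range (n + 1)).filter (fun x => i + x ∉ M' ∧ i + x + 1 ∉ M') with hU'
  have key : ∀ x, x ≠ y → (x ∈ U ↔ x ∈ U') := by
    intro x hxy
    simp only [hU, hU', mem_filter, mem_range]
    by_cases hx : x ≤ n
    · rw [h x hx hxy]
    · constructor <;> rintro ⟨hx', _⟩ <;> omega
  have herase : U.erase y = U'.erase y := by
    ext x
    simp only [mem_erase]
    constructor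
    · rintro ⟨hxy, hx⟩; exact ⟨hxy, (key x hxy).mp hx⟩
    · rintro ⟨hxy, hx⟩; exact ⟨hxy, (key x hxy).mpr hx⟩
  have hyU : y ∈ U ↔ (i + y ∉ M ∧ i + y + 1 ∉ M) := by
    simp only [hU, mem_filter, mem_range, Nat.lt_succ_iff, hy, true_and]
  have hyU' : y ∈ U' ↔ (i + y ∉ M' ∧ i + y + 1 ∉ M') := by
    simp only [hU', mem_filter, mem_range, Nat.lt_succ_iff, hy, true_and]
  rw [← hyU, ← hyU']
  by_cases h1 : y ∈ U <;> by_cases h2 : y ∈ U'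
  · exact ⟨fun _ => h2, fun _ => h1⟩
  · exfalso
    have e1 := card_erase_add_one h1
    have e2 : U'.erase y = U' := Finset.erase_eq_self.mpr h2
    rw [herase, e2] at e1
    omega
  · exfalso
    have e1 := card_erase_add_one h2
    have e2 : U.erase y = U := Finset.erase_eq_self.mpr h1
    rw [← herase, e2] at e1
    omega
  · exact ⟨fun h => absurd h h1, fun h => absurd h h2⟩

/-! ## 2. Events: an adjacent transposition of two prefix-sum lines toggles the uncovered-status of at most its two ends, and of both or none -/

/-- **positions other than the two ends keep their uncovered-status** across an adjacent transposition `(α, κ)` of the prefix-sum lines.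
[folklore] -/
theorem uncovered_iff_of_transposition {i n α κ : ℕ} {θ θ' : ℝ} {M M' : Finset ℕ} (hακ : α < κ) (hκn : κ ≤ n)
    (hM : M ∈ indepSets i n) (hM' : M' ∈ indepSets i n)
    (huniq : ∀ T ∈ indepSets i n, T ≠ M → ∑ t ∈ T, W w₁ w₀ t θ < ∑ t ∈ M, W w₁ w₀ t θ)
    (huniq' : ∀ T ∈ indepSets i n, T ≠ M' → ∑ t ∈ T, W w₁ w₀ t θ' < ∑ t ∈ M', W w₁ w₀ t θ')
    (hord : ∀ p q, p ≤ n → q ≤ n → ¬(p = α ∧ q = κ) → ¬(p = κ ∧ q = α) →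
      (L (altA (shift i w₁)) (altB (shift i w₀)) p θ < L (altA (shift i w₁)) (altB (shift i w₀)) q θ ↔
        L (altA (shift i w₁)) (altB (shift i w₀)) p θ' < L (altA (shift i w₁)) (altB (shift i w₀)) q θ'))
    (hdis : ∀ p q, p ≤ n → q ≤ n → p ≠ q → L (altA (shift i w₁)) (altB (shift i w₀)) p θ ≠ L (altA (shift i w₁)) (altB (shift i w₀)) q θ)
    (hdis' : ∀ p q, p ≤ n → q ≤ n → p ≠ q → L (altA (shift i w₁)) (altB (shift i w₀)) p θ' ≠ L (altA (shift i w₁)) (altB (shift i w₀)) q θ')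
    (hadj : ∀ x, x ≤ n → x ≠ α → x ≠ κ →
      (L (altA (shift i w₁)) (altB (shift i w₀)) x θ < L (altA (shift i w₁)) (altB (shift i w₀)) α θ ↔
        L (altA (shift i w₁)) (altB (shift i w₀)) x θ < L (altA (shift i w₁)) (altB (shift i w₀)) κ θ))
    {x : ℕ} (hx : x ≤ n) (hxα : x ≠ α) (hxκ : x ≠ κ) :
    (i + x ∉ M ∧ i + x + 1 ∉ M) ↔ (i + x ∉ M' ∧ i + x + 1 ∉ M') := by
  have hαn : α ≤ n := hακ.le.trans hκn
  rw [avoid_iff_folds_of_unique w₁ w₀ hM huniq hx, avoid_iff_folds_of_unique w₁ w₀ hM' huniq' hx,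
    touch_iff_of_transposition hακ hκn hord hdis hdis' hadj hx hxκ,
    touch_iff_of_transposition (a := altA (shift 0 (rev i n w₁))) (b := altB (shift 0 (rev i n w₀)))
      (show n - κ < n - α by omega) (Nat.sub_le n α) (rev_ord_of_ord w₁ w₀ hαn hκn hord) (rev_ne_of_ne w₁ w₀ hdis)
      (rev_ne_of_ne w₁ w₀ hdis') (rev_adj_of_adj w₁ w₀ hαn hκn hdis hadj) (Nat.sub_le n x) (by omega)]

/-- **THE EVENT TEST** (LINEAR-LAW §2, kernel form).  Across an adjacent transposition `(α, κ)`, `α < κ ≤ n`, of the prefix-sum lines of the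
block `i+1, …, i+n` (all other pairs keep their order, values distinct at both parameters, no third line between `S_α` and `S_κ` at `θ`), the
unique optimal independent set CHANGES iff
(flip) the pair does change order, (L) `α` is a LEFT RECORD at `θ` (the alternating fold of `S_0, …` touches `S_α`), (M) every line strictly
between `α` and `κ` lies strictly on its correct side of `S_α` at `θ` («clean stretch»; together with (L): the active index just below `κ`
is `α`), and (R) `κ` is a RIGHT RECORD at `θ` (the alternating fold of the reversed block's prefix-sum lines touches its line `n - κ`).
[folklore] -/
theorem ne_iff_event {i n α κ : ℕ} {θ θ' : ℝ} {M M' : Finset ℕ} (hακ : α < κ) (hκn : κ ≤ n)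
    (hM : M ∈ indepSets i n) (hM' : M' ∈ indepSets i n)
    (huniq : ∀ T ∈ indepSets i n, T ≠ M → ∑ t ∈ T, W w₁ w₀ t θ < ∑ t ∈ M, W w₁ w₀ t θ)
    (huniq' : ∀ T ∈ indepSets i n, T ≠ M' → ∑ t ∈ T, W w₁ w₀ t θ' < ∑ t ∈ M', W w₁ w₀ t θ')
    (hord : ∀ p q, p ≤ n → q ≤ n → ¬(p = α ∧ q = κ) → ¬(p = κ ∧ q = α) →
      (L (altA (shift i w₁)) (altB (shift i w₀)) p θ < L (altA (shift i w₁)) (altB (shift i w₀)) q θ ↔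
        L (altA (shift i w₁)) (altB (shift i w₀)) p θ' < L (altA (shift i w₁)) (altB (shift i w₀)) q θ'))
    (hdis : ∀ p q, p ≤ n → q ≤ n → p ≠ q → L (altA (shift i w₁)) (altB (shift i w₀)) p θ ≠ L (altA (shift i w₁)) (altB (shift i w₀)) q θ)
    (hdis' : ∀ p q, p ≤ n → q ≤ n → p ≠ q → L (altA (shift i w₁)) (altB (shift i w₀)) p θ' ≠ L (altA (shift i w₁)) (altB (shift i w₀)) q θ')
    (hadj : ∀ x, x ≤ n → x ≠ α → x ≠ κ →
      (L (altA (shift i w₁)) (altB (shift i w₀)) x θ < L (altA (shift i w₁)) (altB (shift i w₀)) α θ ↔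
        L (altA (shift i w₁)) (altB (shift i w₀)) x θ < L (altA (shift i w₁)) (altB (shift i w₀)) κ θ)) :
    M ≠ M' ↔
      ((L (altA (shift i w₁)) (altB (shift i w₀)) α θ < L (altA (shift i w₁)) (altB (shift i w₀)) κ θ ↔
          ¬ L (altA (shift i w₁)) (altB (shift i w₀)) α θ' < L (altA (shift i w₁)) (altB (shift i w₀)) κ θ') ∧
        fold (altA (shift i w₁)) (altB (shift i w₀)) α θ = L (altA (shift i w₁)) (altB (shift i w₀)) α θ ∧
        θ ∈ I (altA (shift i w₁)) (altB (shift i w₀)) (κ - 1) α ∧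
        fold (altA (shift 0 (rev i n w₁))) (altB (shift 0 (rev i n w₀))) (n - κ) θ =
          L (altA (shift 0 (rev i n w₁))) (altB (shift 0 (rev i n w₀))) (n - κ) θ) := by
  have hαn : α ≤ n := hακ.le.trans hκn
  -- hypotheses for the reversed family, pair `(n - κ, n - α)`
  have hord' := rev_ord_of_ord w₁ w₀ hαn hκn hord
  have hdisR := rev_ne_of_ne w₁ w₀ (n := n) hdis
  have hdisR' := rev_ne_of_ne w₁ w₀ (n := n) hdis'
  have hadj' := rev_adj_of_adj w₁ w₀ hαn hκn hdis hadj
  -- the right touch at `κ` is common to `θ` and `θ'`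
  have hR : fold (altA (shift 0 (rev i n w₁))) (altB (shift 0 (rev i n w₀))) (n - κ) θ = L (altA (shift 0 (rev i n w₁))) (altB (shift 0 (rev i n w₀))) (n - κ) θ ↔
      fold (altA (shift 0 (rev i n w₁))) (altB (shift 0 (rev i n w₀))) (n - κ) θ' = L (altA (shift 0 (rev i n w₁))) (altB (shift 0 (rev i n w₀))) (n - κ) θ' :=
    touch_iff_of_transposition (show n - κ < n - α by omega) (Nat.sub_le n α) hord' hdisR hdisR' hadj' (Nat.sub_le n κ)
      (by omega)
  -- uncovered-status of `κ` at the two parameters, in fold language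
  have hκθ := avoid_iff_folds_of_unique w₁ w₀ hM huniq hκn
  have hκθ' := avoid_iff_folds_of_unique w₁ w₀ hM' huniq' hκn
  -- the active index below `κ` is common
  have hlab : lab (altA (shift i w₁)) (altB (shift i w₀)) (κ - 1) θ = lab (altA (shift i w₁)) (altB (shift i w₀)) (κ - 1) θ' :=
    lab_eq_of_transposition_lt hκn hord (by omega)
  -- `gap` form of the comparison of the special pair at a parameter with distinct values
  have hG : ∀ τ : ℝ, L (altA (shift i w₁)) (altB (shift i w₀)) α τ ≠ L (altA (shift i w₁)) (altB (shift i w₀)) κ τ →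
      (0 < gap κ (L (altA (shift i w₁)) (altB (shift i w₀)) κ τ) (L (altA (shift i w₁)) (altB (shift i w₀)) α τ) ↔ ((Even κ ∧ ¬ L (altA (shift i w₁)) (altB (shift i w₀)) α τ < L (altA (shift i w₁)) (altB (shift i w₀)) κ τ) ∨ (¬ Even κ ∧ L (altA (shift i w₁)) (altB (shift i w₀)) α τ < L (altA (shift i w₁)) (altB (shift i w₀)) κ τ))) := by
    intro τ hne
    unfold gap
    split_ifs with he
    · rw [sub_pos]
      constructor
      · intro h; exact Or.inl ⟨he, fun h' => lt_asymm h h'⟩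
      · rintro (⟨_, h⟩ | ⟨h, _⟩)
        · exact lt_of_le_of_ne (not_lt.mp h) (Ne.symm hne)
        · exact absurd he h
    · rw [sub_pos]
      constructor
      · intro h; exact Or.inr ⟨he, h⟩
      · rintro (⟨h, _⟩ | ⟨_, h⟩)
        · exact absurd h he
        · exact h
  have hGθ := hG θ (hdis α κ hαn hκn (by omega))
  have hGθ' := hG θ' (hdis' α κ hαn hκn (by omega))
  constructor
  · -- (⟹) some position changes status; by `uncovered_iff_of_transposition` and parity it is `κ`; read the conditions off `κ`
    intro hne
    have hκch : ¬ ((i + κ ∉ M ∧ i + κ + 1 ∉ M) ↔ (i + κ ∉ M' ∧ i + κ + 1 ∉ M')) := by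
      intro hκeq
      apply hne
      refine eq_of_avoid_iff hM hM' fun x hx => ?_
      by_cases hxκ : x = κ
      · rw [hxκ]; exact hκeq
      · by_cases hxα : x = α
        · rw [hxα]
          refine uncovered_iff_of_all_but_one hM hM' fun y hy hyα => ?_
          by_cases hyκ : y = κ
          · rw [hyκ]; exact hκeq
          · exact uncovered_iff_of_transposition w₁ w₀ hακ hκn hM hM' huniq huniq' hord hdis hdis' hadj hy hyα hyκ
        · exact uncovered_iff_of_transposition w₁ w₀ hακ hκn hM hM' huniq huniq' hord hdis hdis' hadj hx hxα hxκ
    rw [hκθ, hκθ'] at hκch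
    -- the right touch is common, so it holds and the left touch at `κ` differs
    have hRt : fold (altA (shift 0 (rev i n w₁))) (altB (shift 0 (rev i n w₀))) (n - κ) θ = L (altA (shift 0 (rev i n w₁))) (altB (shift 0 (rev i n w₀))) (n - κ) θ := by
      by_contra hnot
      exact hκch ⟨fun h => absurd h.2 hnot, fun h => absurd h.2 (fun h2 => hnot (hR.mpr h2))⟩
    have hLch : ¬ (fold (altA (shift i w₁)) (altB (shift i w₀)) κ θ = L (altA (shift i w₁)) (altB (shift i w₀)) κ θ ↔
        fold (altA (shift i w₁)) (altB (shift i w₀)) κ θ' = L (altA (shift i w₁)) (altB (shift i w₀)) κ θ') := fun hL => hκch (and_congr hL hR)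
    -- hence the active index below `κ` is `α` (else the left touch would agree): (L) and (M)
    have hjα : lab (altA (shift i w₁)) (altB (shift i w₀)) (κ - 1) θ = α := by
      by_contra h
      exact hLch (touch_larger_iff_of_ne hακ hκn hord h)
    have hLM := (lab_pred_eq_iff _ _ hακ θ).mp hjα
    refine ⟨?_, hLM.1, hLM.2, hRt⟩
    -- (flip): the two touch tests at `κ` are the two `gap` conditions, which therefore differ
    have hTθ := touch_larger_iff_gap hακ hκn hdis hjα
    have hTθ' := touch_larger_iff_gap hακ hκn hdis' (hlab.symm.trans hjα)
    rw [hTθ, hTθ', hGθ, hGθ'] at hLch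
    by_cases he : Even κ
    · simp only [he, true_and, not_true_eq_false, false_and, or_false] at hLch
      have h2 := _root_.not_iff.mp hLch
      rwa [not_not] at h2
    · simp only [he, false_and, not_false_eq_true, true_and, false_or] at hLch
      exact (not_iff_comm.mp (_root_.not_iff.mp hLch)).symm
  · -- (⟸) the conditions make the left touch at `κ` differ while the right touch holds: `κ` changes status
    rintro ⟨hflip, hLrec, hMid, hRt⟩ hMM'
    subst hMM'
    have hjα : lab (altA (shift i w₁)) (altB (shift i w₀)) (κ - 1) θ = α := (lab_pred_eq_iff _ _ hακ θ).mpr ⟨hLrec, hMid⟩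
    have hTθ := touch_larger_iff_gap hακ hκn hdis hjα
    have hTθ' := touch_larger_iff_gap hακ hκn hdis' (hlab.symm.trans hjα)
    have h1 := hκθ.symm.trans hκθ'
    rw [hTθ, hTθ', hGθ, hGθ'] at h1
    have hRt' := hR.mp hRt
    have h2 := (and_iff_left hRt).symm.trans (h1.trans (and_iff_left hRt'))
    by_cases he : Even κ
    · simp only [he, true_and, not_true_eq_false, false_and, or_false] at h2
      by_cases hb : L (altA (shift i w₁)) (altB (shift i w₀)) α θ < L (altA (shift i w₁)) (altB (shift i w₀)) κ θ
      · exact (h2.mpr (hflip.mp hb)) hb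
      · exact hb (hflip.mpr (h2.mp hb))
    · simp only [he, false_and, not_false_eq_true, true_and, false_or] at h2
      by_cases hb : L (altA (shift i w₁)) (altB (shift i w₀)) α θ < L (altA (shift i w₁)) (altB (shift i w₀)) κ θ
      · exact (hflip.mp hb) (h2.mp hb)
      · exact hb (h2.mpr (by_contra fun hb' => hb (hflip.mpr hb')))

/-- **EVENTS TOGGLE EXACTLY THE TWO ENDS**: across an adjacent transposition `(α, κ)` of the prefix-sum lines, if the unique optimum changes
then position `α` and position `κ` both change their uncovered-status and no other position does (LINEAR-LAW §3(c): «every event toggles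
left-record status at its right end and right-record status at its left end»). [folklore] -/
theorem toggle_ends_of_ne {i n α κ : ℕ} {θ θ' : ℝ} {M M' : Finset ℕ} (hακ : α < κ) (hκn : κ ≤ n)
    (hM : M ∈ indepSets i n) (hM' : M' ∈ indepSets i n)
    (huniq : ∀ T ∈ indepSets i n, T ≠ M → ∑ t ∈ T, W w₁ w₀ t θ < ∑ t ∈ M, W w₁ w₀ t θ)
    (huniq' : ∀ T ∈ indepSets i n, T ≠ M' → ∑ t ∈ T, W w₁ w₀ t θ' < ∑ t ∈ M', W w₁ w₀ t θ')
    (hord : ∀ p q, p ≤ n → q ≤ n → ¬(p = α ∧ q = κ) → ¬(p = κ ∧ q = α) →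
      (L (altA (shift i w₁)) (altB (shift i w₀)) p θ < L (altA (shift i w₁)) (altB (shift i w₀)) q θ ↔
        L (altA (shift i w₁)) (altB (shift i w₀)) p θ' < L (altA (shift i w₁)) (altB (shift i w₀)) q θ'))
    (hdis : ∀ p q, p ≤ n → q ≤ n → p ≠ q → L (altA (shift i w₁)) (altB (shift i w₀)) p θ ≠ L (altA (shift i w₁)) (altB (shift i w₀)) q θ)
    (hdis' : ∀ p q, p ≤ n → q ≤ n → p ≠ q → L (altA (shift i w₁)) (altB (shift i w₀)) p θ' ≠ L (altA (shift i w₁)) (altB (shift i w₀)) q θ')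
    (hadj : ∀ x, x ≤ n → x ≠ α → x ≠ κ →
      (L (altA (shift i w₁)) (altB (shift i w₀)) x θ < L (altA (shift i w₁)) (altB (shift i w₀)) α θ ↔
        L (altA (shift i w₁)) (altB (shift i w₀)) x θ < L (altA (shift i w₁)) (altB (shift i w₀)) κ θ))
    (hne : M ≠ M') :
    ¬ ((i + α ∉ M ∧ i + α + 1 ∉ M) ↔ (i + α ∉ M' ∧ i + α + 1 ∉ M')) ∧
      ¬ ((i + κ ∉ M ∧ i + κ + 1 ∉ M) ↔ (i + κ ∉ M' ∧ i + κ + 1 ∉ M')) ∧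
      ∀ x, x ≤ n → x ≠ α → x ≠ κ → ((i + x ∉ M ∧ i + x + 1 ∉ M) ↔ (i + x ∉ M' ∧ i + x + 1 ∉ M')) := by
  have hαn : α ≤ n := hακ.le.trans hκn
  have hothers : ∀ x, x ≤ n → x ≠ α → x ≠ κ → ((i + x ∉ M ∧ i + x + 1 ∉ M) ↔ (i + x ∉ M' ∧ i + x + 1 ∉ M')) :=
    fun x hx hxα hxκ => uncovered_iff_of_transposition w₁ w₀ hακ hκn hM hM' huniq huniq' hord hdis hdis' hadj hx hxα hxκ
  -- if one end kept its status, parity would force the other end to keep it too, and then `M = M'`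
  have key : ∀ y z, (y = α ∧ z = κ) ∨ (y = κ ∧ z = α) →
      ((i + y ∉ M ∧ i + y + 1 ∉ M) ↔ (i + y ∉ M' ∧ i + y + 1 ∉ M')) → False := by
    rintro y z hyz hy
    have hz : (i + z ∉ M ∧ i + z + 1 ∉ M) ↔ (i + z ∉ M' ∧ i + z + 1 ∉ M') := by
      refine uncovered_iff_of_all_but_one hM hM' fun x hx hxz => ?_
      by_cases hxy : x = y
      · rw [hxy]; exact hy
      · rcases hyz with ⟨rfl, rfl⟩ | ⟨rfl, rfl⟩
        · exact hothers x hx hxy hxz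
        · exact hothers x hx hxz hxy
    apply hne
    refine eq_of_avoid_iff hM hM' fun x hx => ?_
    by_cases hxy : x = y
    · rw [hxy]; exact hy
    · by_cases hxz : x = z
      · rw [hxz]; exact hz
      · rcases hyz with ⟨rfl, rfl⟩ | ⟨rfl, rfl⟩
        · exact hothers x hx hxy hxz
        · exact hothers x hx hxz hxy
  exact ⟨fun h => key α κ (Or.inl ⟨rfl, rfl⟩) h, fun h => key κ α (Or.inr ⟨rfl, rfl⟩) h, hothers⟩

/-- **every change of the optimum is witnessed by a change of order of some pair of prefix-sum lines** (contrapositive of the order lemma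
`eq_of_order`): along a sweep of the parameter the optimal independent set can change only at crossings of the arrangement `S_0, …, S_n`. [folklore] -/
theorem exists_pair_of_ne {i n : ℕ} {θ θ' : ℝ} {M M' : Finset ℕ} (hM : M ∈ indepSets i n) (hM' : M' ∈ indepSets i n)
    (huniq : ∀ T ∈ indepSets i n, T ≠ M → ∑ t ∈ T, W w₁ w₀ t θ < ∑ t ∈ M, W w₁ w₀ t θ)
    (huniq' : ∀ T ∈ indepSets i n, T ≠ M' → ∑ t ∈ T, W w₁ w₀ t θ' < ∑ t ∈ M', W w₁ w₀ t θ') (hne : M ≠ M') :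
    ∃ p q, p ≤ n ∧ q ≤ n ∧
      ¬ (L (altA (shift i w₁)) (altB (shift i w₀)) p θ < L (altA (shift i w₁)) (altB (shift i w₀)) q θ ↔
          L (altA (shift i w₁)) (altB (shift i w₀)) p θ' < L (altA (shift i w₁)) (altB (shift i w₀)) q θ') := by
  by_contra h
  push Not at h
  exact hne (eq_of_order w₁ w₀ hM hM' huniq huniq' fun p q hp hq => h p q hp hq)

end Events

end

end StaticPathFold

end Summit.ValiantsHypothesis.ValiantsHypothesis.Theorems.KPlusLogSqLaw
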